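import Summits.ABC.IUTFork.Cor312PilotIdelesPrContentBound
import Summits.ABC.IUTFork.Cor312ThetaLocalGeContentHullSharp
import Summits.ABC.IUTFork.Cor312IsmFullDH
import Summits.ABC.IUTFork.Cor312ThetaSideOrbitHullM
import HarnessLib

/-!
# [IUTchIII] Corollary 3.12 at the print-normalised SHARP real setting — the Θ-side local term IS the orbit-hull sum:
# `−|log(Θ)|_{i+1,p} = Σ_{v⃗} Pr(v⃗)·log μ̄_{v⃗}(hull(Ind2·⋃_a ι_a(t_{Θ,i+1,v_a})·(R_I)^∼))` (ANY base field, ANY Θ-ideles)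

PROOF-ONLY support file (D-0012; no definitions, no `Prop` facts) of the abc-iut cell (R2 S-chain team, seat abc-iut-s2-p7
gen 3, TARGET #2 `hΘ … (or =)` — the «(or =)» half on the NONARCHIMEDEAN side). TAKES NO SIDE on [IUTchIII] Cor. 3.12.
The REVERSE twin of this seat's `Cor312PilotIdelesPrContentBound` (gen 0, p438921: at abc-iut-c312-7's
`Real.settingPrVolSharp X hlog …` — [IUTchIII] Cor. 3.12's setting over the REAL log-shells of the field `F` of the pilot data `X`,
ALL places over each `p`, packet-normalised volumes `Pr(v⃗)`, SHARP Dupuy–Hilado Θ-boxes `ι_j(t_{Θ,j,v_j})·(R_I)^∼` read off Θ-ideles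
`t` — `−|log(Θ)|_{i+1,p} ≤ Σ_{v⃗} Pr(v⃗)·(−m(v⃗)·log p + log μ̄_{v⃗}(hull(log_p(R_{v⃗}^×))))` for every capsule-symmetric family `m`
bracketing the slots). THIS file instantiates abc-iut-s2-p9's generic REVERSE inequality `Cor312Vol.sum_content_hull_le_thetaLocal_untopD`
(`Cor312ThetaLocalGeContentHull`, p448133: the `ℤ`-span of the FACTORWISE (Ind2)-orbit of one vector of exact content fills
`p^m·log_p(R_I^×)`) at the same setting, discharging its two hypotheses for the real Dupuy–Hilado signature of ANY number field
(the `F`/`K`-level twin of abc-iut-s2-p9's M-level `Cor312ThetaSideEqualM`):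

* §1 `exists_indGroup_comparison_eq_congr_presAt` — `hism`: every factorwise family of shell-preserving `ℚ_p`-linear automorphisms
  on a summand is realised by the indeterminacy group, because Ism of `Real.logShellsDH` is FULL — abc-iut-s2-p9's
  `exists_ismDH_presAt_of_image_logUnits_eq` (`Cor312IsmFullDH`, p449844: at a place `v | p` of `F` every `ℚ_p`-linear automorphism of
  the presented field `F_v`, `φ_v = id`, mapping `log_p(𝒪^×)` onto itself is bicontinuous and shell-preserving, i.e. IS an element of
  `Real.ismDH`; Dupuy–Hilado §4.9: Ism = ALL lattice automorphisms) + abc-iut-s2-p9's `Cor312Vol.exists_indGroup_comparison_eq_congr`;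
* §2 `sharpBoxDH_eq_sharpBox`, `thetaRegion3_settingPrVolSharp_eq_preimage_pi_sharpBox` — the (Ind3)-region of the sharp setting IS
  the product `e⁻¹(Π_{v⃗} sharpBox_{v⃗})` of the last-slot boxes in abc-iut-s2-p8's generic `PadicPresentation.sharpBox` form (so abc-iut-s2-p9's
  `exists_mem_sUnion_possibleImages_exact_content_of_sharpBox`, `Cor312ThetaLocalGeContentHullSharp` p450136, supplies `hwit`: an exact-content
  vector of the slot union `⋃_a ι_a(t_a)·(R_I)^∼` lies in some slot, i.e. in an (Ind1)-image of a last-slot box); `HullDefined` comes from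
  abc-iut-c312-7's `ThetaFinite` (`bridgeHyps_settingPrVolSharp_of_ideles`, abc-iut-c312-6 `hullDefined_of_finite`);
* §3 **`sum_content_hull_le_thetaLocal_settingPrVolSharp_untopD`** (the reverse inequality for the EXACT content family of the slot
  unions), **`thetaLocal_settingPrVolSharp_eq_sum_content_hull`** (with gen 0's `≤`: EQUALITY — capsule symmetry of an exact family is
  automatic, gen 0 `Cor312Vol.content_slotUnion_perm`), and the hypothesis-free ORBIT form
  **`thetaLocal_settingPrVolSharp_eq_sum_orbitHull`**: `−|log(Θ)|_{i+1,p} = ↑(Σ_{v⃗} Pr(v⃗)·log μ̄_{v⃗}(hull(⋃_{g∈Ind2} g·⋃_a ι_a(t_{Θ,i+1,v_a})·(R_I)^∼)))`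
  for EVERY pilot data `X`, every non-zero Θ-ideles `t` (units off `S`) and `q`-ideles `tq` — print's factorwise (Ind2) and Dupuy–Hilado's
  full lattice group give the SAME local Θ-volume at every packet of the real log-shells (question (N1) of HOME/STATUS 11:18Z at the
  `F`/`K` level; the M level is abc-iut-s2-p9's `thetaLocal_settingPrVolSharpM_tOfIdeleData_eq_orbitSumM`).

USE (sequel `Cor312ThetaSideExactK`): at `X := pilotDataOfK D K` the exact contents are abc-iut-c312-3's genuine content family read
below the tuples (abc-iut-s2-p6 `Cor312Prov.content_slotUnion_eq_contentFamily_below`, p448377), whence with abc-iut-s2-p6's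
`procAvg_sum_weightPr_content_below_eq_negLogThetaLoc` the NONARCHIMEDEAN EXACTNESS `−|log(Θ)|(settingPrVolSharp (pilotDataOfK D K) …) =
↑I.negLogThetaNonarch`. [cite: Mochizuki2012, IUTchIII Thm. 3.11 (i) (Ind1), (Ind2) p. 154] [cite: Mochizuki2012, IUTchIV Thm. 1.10
Step (v) p. 27–28] [cite: DupuyHilado2025, §3.7, §3.9, §4.7, §4.9, §4.12] [cite: WeilBNT1967, Ch. II §2, Th. 2]
[claim: Mochizuki2012, status: disputed] for every quoted construction. HONEST FRAMING: identities between OUR typed objects at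
ONE instantiation (sharp (Ind3) reading, DH-level (Ind1)/(Ind2), trivial archimedean container); nothing here asserts or denies
Cor. 3.12 for any initial Θ-data or takes a side on any author; typed ≠ proved; instantiated ≠ endorsed.
-/

noncomputable section

open Set Function NumberField IsDedekindDomain
open scoped Pointwise

namespace Summit.ABC

namespace IUTFork

namespace Thm311

namespace Real

open Cor312 Cor312Vol Literature.IUT.LogThetaLattice Literature.IUT.LogVolume

variable {F : Type} [Field F] [NumberField F] (X : PilotData F) {logv : PadicLogs F} (hlog : LogvAnalytic logv)

/-! ## §1. `hism`: factorwise families are realised by the indeterminacy group (Ism of the real signature is FULL, abc-iut-s2-p9) -/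

variable (M : Type) [Field M] [NumberField M]
  (archPk : ∀ (j : (thetaIndex X).Label) (vQ : (thetaIndex X).VQ), Set ((logShellsDH X logv).Packet j vQ))
  (archSub : ∀ (j : (thetaIndex X).Label) (v : (thetaIndex X).V),
    Set ((logShellsDH X logv).Packet j ((thetaIndex X).over v)))
  (Ψ : ℤ → ∀ v : (thetaIndex X).V, v ∈ (thetaIndex X).Vbad → Set ((logShellsDH X logv).StarPacket v))
  (act : ℤ → ∀ v : (thetaIndex X).V, v ∈ (thetaIndex X).Vbad →
    (logShellsDH X logv).StarPacket v → Module.End ℚ ((logShellsDH X logv).StarPacket v))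
  (Mmod : ℤ → ∀ j : (thetaIndex X).LabelStar, Set ((logShellsDH X logv).GlobalPacket j.1))
  (region : ℤ → ∀ j : (thetaIndex X).LabelStar, FinDivisor M → ∀ vQ : (thetaIndex X).VQ,
    Set ((logShellsDH X logv).Packet j.1 vQ))

/-- **`hism` for the real Dupuy–Hilado signature**: every factorwise family of shell-preserving `ℚ_p`-linear automorphisms on a
summand `v⃗` is realised there by a member of the indeterminacy group of abc-iut-c312-7's packet-normalised real situation — Ism of
`Real.logShellsDH` is FULL (abc-iut-s2-p9 `exists_ismDH_presAt_of_image_logUnits_eq`, `Cor312IsmFullDH`: every `ℚ_p`-linear automorphism of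
`F_v` mapping `log_p(𝒪^×)` onto itself is bicontinuous and shell-preserving, Dupuy–Hilado §4.9) + abc-iut-s2-p9's
`Cor312Vol.exists_indGroup_comparison_eq_congr`. [cite: DupuyHilado2025, §4.9] [cite: Mochizuki2012, IUTchIII Thm. 3.11 (i) (Ind2) p. 154] -/
theorem exists_indGroup_comparison_eq_congr_presAt (j : (thetaIndex X).Label) (pp : Nat.Primes)
    (e : (thetaIndex X).Caps j → (thetaIndex X).Fibre (.inr pp))
    (g' : haveI : Fact (pp : ℕ).Prime := ⟨pp.2⟩; ∀ a, (presAt X hlog pp).kk e a ≃ₗ[ℚ_[pp]] (presAt X hlog pp).kk e a)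
    (hg' : haveI : Fact (pp : ℕ).Prime := ⟨pp.2⟩
      ∀ a, g' a '' logUnits ((presAt X hlog pp).kk e a) = logUnits ((presAt X hlog pp).kk e a)) :
    haveI : Fact (pp : ℕ).Prime := ⟨pp.2⟩
    ∃ Φ ∈ Cor312.Setting.indGroup (situationPrVol X hlog M archPk archSub Ψ act Mmod region), ∀ x,
      (presAtPr X hlog pp).comparison j (Φ j (.inr pp) x) e =
        (PiTensorProduct.congr g' : (presAt X hlog pp).X e ≃ₗ[ℚ_[pp]] (presAt X hlog pp).X e)
          ((presAtPr X hlog pp).comparison j x e) :=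
  haveI : Fact (pp : ℕ).Prime := ⟨pp.2⟩
  exists_indGroup_comparison_eq_congr (S := situationPrVol X hlog M archPk archSub Ψ act Mmod region) (presAtPr X hlog pp) j
    (fun v g'' hg'' => exists_ismDH_presAt_of_image_logUnits_eq X pp.1 logv (hlog pp) v g'' hg'') e g' hg'

variable (n : ℤ) {HT : Type} {LogLink : HT → HT → Type} {IsFull : ∀ {s t : HT}, LogLink s t → Prop}
  (lat : LGPGaussianLogThetaLattice LogLink IsFull)
  {Frd : Type} {IsoF : Frd → Frd → Type} {Ob : Frd → Type} {realify : Frd → Frd} {Strip : Type}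
  {IsoS : Strip → Strip → Type} {Mv : ∀ v : (thetaIndex X).V, v ∈ (thetaIndex X).Vbad → Type}
  [∀ v h, Monoid (Mv v h)]
  (sig : GlobalLGPFrobenioidSignature (thetaIndex X).lstar (thetaIndex X).V (· ∈ (thetaIndex X).Vbad)
    Frd IsoF Ob realify Strip IsoS Mv)
  (split : SplittingMonoids Mv) {ObΔ : Type} {N : ∀ v : (thetaIndex X).V, v ∈ (thetaIndex X).Vbad → Type}
  [∀ v h, Monoid (N v h)] (qData : QPilotData ObΔ N)
  (t : ∀ (pp : Nat.Primes) (_ : Fin X.lstar) (x : (thetaIndex X).Fibre (.inr pp)),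
    haveI : Fact (pp : ℕ).Prime := ⟨pp.2⟩; kOf X pp.1 x)
  (tq : ∀ (pp : Nat.Primes) (x : (thetaIndex X).Fibre (.inr pp)), haveI : Fact (pp : ℕ).Prime := ⟨pp.2⟩; kOf X pp.1 x)
  (htq0 : ∀ pp x, tq pp x ≠ 0)
  (htq1 : ∀ (pp : Nat.Primes) (x : (thetaIndex X).Fibre (.inr pp)),
    haveI : Fact (pp : ℕ).Prime := ⟨pp.2⟩; placeOf X pp.1 x ∉ X.S → ‖tq pp x‖ = 1)

/-! ## §2. The (Ind3)-region of the sharp setting is the product of the last-slot sharp boxes -/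

/-- abc-iut-c312-3's sharp box family `Real.sharpBoxDH X hlog t pp` IS abc-iut-s2-p8's generic `PadicPresentation.sharpBox` of the
presentation `presAt X hlog pp` at the idele family `t pp` (same formula). [cite: DupuyHilado2025, §3.7, §3.9] -/
theorem sharpBoxDH_eq_sharpBox (pp : Nat.Primes) (j : (thetaIndex X).Label) :
    haveI : Fact (pp : ℕ).Prime := ⟨pp.2⟩
    sharpBoxDH X hlog t pp j = (presAt X hlog pp).sharpBox (t pp) j :=
  rfl

/-- The (Ind3)-enlarged Θ-region of `settingPrVolSharp` at `(j, p)` IS `e⁻¹(Π_{v⃗} ι_j(t_{Θ,j,v_j})·(R_I)^∼)`, the product of the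
last-slot sharp boxes, in abc-iut-s2-p8's GENERIC `PadicPresentation.sharpBox` form (abc-iut-c312-7 `thetaRegion3_thetaBoxDH_Pr`,
abc-iut-s2-p8 `factorMap_preimage_boxOf_sharpBox`; the `sharpBoxDH` form is abc-iut-s2-p6's `thetaRegion3_settingPrVolSharp_eq_preimage_pi`,
`Cor312ThetaLocalLowerPrVolTuple`). [cite: DupuyHilado2025, §3.7, §4.10] -/
theorem thetaRegion3_settingPrVolSharp_eq_preimage_pi_sharpBox (j : (thetaIndex X).Label) (pp : Nat.Primes) :
    haveI : Fact (pp : ℕ).Prime := ⟨pp.2⟩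
    (settingPrVolSharp X hlog M archPk archSub Ψ act Mmod region n lat sig split qData tq t htq0 htq1).thetaRegion3 j (.inr pp) =
      (presAtPr X hlog pp).comparison j ⁻¹' Set.pi univ ((presAtPr X hlog pp).sharpBox (t pp) j) := by
  haveI : Fact (pp : ℕ).Prime := ⟨pp.2⟩
  show (settingPrVol X hlog M archPk archSub Ψ act Mmod region n lat sig split qData
      (fun _ _ => thetaBoxDH X hlog (sharpBoxDH X hlog t)) (fun _ => qCentreDH X hlog tq) (qCentreDH_ne_zero X hlog tq htq0)
      (finite_support_logvol_qRegion_Pr X hlog M archPk archSub Ψ act Mmod region n tq htq0 htq1)).thetaRegion3 j (.inr pp) = _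
  rw [thetaRegion3_thetaBoxDH_Pr]
  exact (presAtPr X hlog pp).factorMap_preimage_boxOf_sharpBox (t pp) j

/-! ## §3. The reverse inequality, the EQUALITY with the exact content family, and the orbit-hull form -/

/-- **`Σ_{v⃗} Pr(v⃗)·(−m(v⃗)·log p + log μ̄_{v⃗}(hull(log_p(R_{v⃗}^×)))) ≤ (−|log(Θ)|_{i+1,p}).untopD 0`** at `settingPrVolSharp` for the EXACT
content family `m` of the slot unions `⋃_a ι_a(t_{Θ,i+1,v_a})·(R_I)^∼` (`hm0`/`hm1`): abc-iut-s2-p9's generic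
`Cor312Vol.sum_content_hull_le_thetaLocal_untopD` with `hframe := rfl`, `hvol :=` abc-iut-c312-5's `SummandPieces.logvol_preimage_pi`,
`hism` from §1 and `hwit` from abc-iut-s2-p9's `exists_mem_sUnion_possibleImages_exact_content_of_sharpBox` (`Cor312ThetaLocalGeContentHullSharp`:
an exact-content vector of the slot union lies in some slot, i.e. in an (Ind1)-image of a last-slot box) on §2's product of sharp boxes.
No capsule symmetry is needed in this direction.
[cite: Mochizuki2012, IUTchIV Thm. 1.10 Step (v) p. 27–28] [cite: DupuyHilado2025, §4.9, §4.12] -/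
theorem sum_content_hull_le_thetaLocal_settingPrVolSharp_untopD (ht0 : ∀ pp i x, t pp i x ≠ 0)
    (ht1 : ∀ (pp : Nat.Primes) (i : Fin X.lstar) (x : (thetaIndex X).Fibre (.inr pp)),
      haveI : Fact (pp : ℕ).Prime := ⟨pp.2⟩; placeOf X pp.1 x ∉ X.S → ‖t pp i x‖ = 1)
    (i : Fin (thetaIndex X).lstar) (pp : Nat.Primes)
    (m : ((thetaIndex X).Caps (Setting.labelSucc i) → (thetaIndex X).Fibre (.inr pp)) → ℤ)
    (hm0 : ∀ e : (thetaIndex X).Caps (Setting.labelSucc i) → (thetaIndex X).Fibre (.inr pp),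
      haveI : Fact (pp : ℕ).Prime := ⟨pp.2⟩
      (⋃ a, iota pp.1 ((presAt X hlog pp).kk e) a (t pp i (e a)) •
          (normalizedPacket pp.1 ((presAt X hlog pp).kk e) : Set ((presAt X hlog pp).X e))) ⊆
        (((pp : ℕ) : ℚ_[pp]) ^ m e) • (logPacket pp.1 ((presAt X hlog pp).kk e) : Set ((presAt X hlog pp).X e)))
    (hm1 : ∀ e : (thetaIndex X).Caps (Setting.labelSucc i) → (thetaIndex X).Fibre (.inr pp),
      haveI : Fact (pp : ℕ).Prime := ⟨pp.2⟩
      ¬ (⋃ a, iota pp.1 ((presAt X hlog pp).kk e) a (t pp i (e a)) •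
          (normalizedPacket pp.1 ((presAt X hlog pp).kk e) : Set ((presAt X hlog pp).X e))) ⊆
        (((pp : ℕ) : ℚ_[pp]) ^ (m e + 1)) • (logPacket pp.1 ((presAt X hlog pp).kk e) : Set ((presAt X hlog pp).X e))) :
    haveI : Fact (pp : ℕ).Prime := ⟨pp.2⟩
    ∑ e : (presAt X hlog pp).toLocalPieces.E (Setting.labelSucc i),
        weightPr X pp.1 (Setting.labelSucc i) e * (-(m e * Real.log pp) +
          packetLogμ pp.1 ((presAt X hlog pp).kk e)
            (packetHull pp.1 ((presAt X hlog pp).kk e)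
              (logPacket pp.1 ((presAt X hlog pp).kk e) : Set ((presAt X hlog pp).X e)))) ≤
      ((settingPrVolSharp X hlog M archPk archSub Ψ act Mmod region n lat sig split qData tq t htq0 htq1).thetaLocal
        (Setting.labelSucc i) (.inr pp)).untopD 0 := by
  haveI : Fact (pp : ℕ).Prime := ⟨pp.2⟩
  letI : Fintype ((thetaIndex X).Caps (Setting.labelSucc i) → (thetaIndex X).Fibre (.inr pp)) := Fintype.ofFinite _
  letI : Fintype ((presAtPr X hlog pp).factorIdx (Setting.labelSucc i)) :=
    factorIdxDH_fintype X hlog (Setting.labelSucc i) (.inr pp)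
  -- `hframe`: the setting's frame IS the pulled-back real frame of the presentation (definitionally)
  have hframe : (settingPrVolSharp X hlog M archPk archSub Ψ act Mmod region n lat sig split qData tq t htq0 htq1).frame
      (Setting.labelSucc i) (.inr pp) =
      HullFrame.ofComparison ((presAtPr X hlog pp).factorField (Setting.labelSucc i))
        (fun x => (presAtPr X hlog pp).factorMap (Setting.labelSucc i) x) := rfl
  -- `hvol`: the line carries the probability-weighted container (abc-iut-c312-5 `logvol_preimage_pi`)
  have hvol : ∀ R : ∀ e : (thetaIndex X).Caps (Setting.labelSucc i) → (thetaIndex X).Fibre (.inr pp),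
      Set ((presAtPr X hlog pp).X e),
      (∀ e, PacketAdm pp.1 ((presAtPr X hlog pp).kk e) (R e)) →
        ((situationPrVol X hlog M archPk archSub Ψ act Mmod region).D n).logvol (Setting.labelSucc i) (.inr pp)
          ((presAtPr X hlog pp).comparison (Setting.labelSucc i) ⁻¹' Set.pi univ R) =
        ∑ e, (presAtPr X hlog pp).w (Setting.labelSucc i) e * packetLogμ pp.1 ((presAtPr X hlog pp).kk e) (R e) :=
    fun R hR => ((realizes_situationPrVol X hlog M archPk archSub Ψ act Mmod region n).logvol_eq _ (.inr pp) _).trans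
      (SummandPieces.logvol_preimage_pi (summandPiecesPr X hlog) _ (.inr pp) hR)
  have key := @sum_content_hull_le_thetaLocal_untopD (thetaIndex X)
    (situationPrVol X hlog M archPk archSub Ψ act Mmod region)
    (settingPrVolSharp X hlog M archPk archSub Ψ act Mmod region n lat sig split qData tq t htq0 htq1) (.inr pp) pp.1 ⟨pp.2⟩
    (presAtPr X hlog pp) i _ _
    (hullDefined_of_finite (bridgeHyps_settingPrVolSharp_of_ideles X hlog M archPk archSub Ψ act Mmod region n lat sig split qData
      t tq ht0 ht1 htq0 htq1) i _)
    hframe hvol m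
    (fun e => exists_mem_sUnion_possibleImages_exact_content_of_sharpBox
      (S := situationPrVol X hlog M archPk archSub Ψ act Mmod region)
      (P := settingPrVolSharp X hlog M archPk archSub Ψ act Mmod region n lat sig split qData tq t htq0 htq1)
      (presAtPr X hlog pp) (t pp) i
      (thetaRegion3_settingPrVolSharp_eq_preimage_pi_sharpBox X hlog M archPk archSub Ψ act Mmod region n lat sig split qData t tq htq0 htq1
        (Setting.labelSucc i) pp) e (m e) (hm0 e) (hm1 e))
    (fun e g' hg' => exists_indGroup_comparison_eq_congr_presAt X hlog M archPk archSub Ψ act Mmod region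
      (Setting.labelSucc i) pp e g' hg')
  exact key

/-- **THE LOCAL Θ-VOLUME IS PINNED: `−|log(Θ)|_{i+1,p} = ↑(Σ_{v⃗} Pr(v⃗)·(−m(v⃗)·log p + log μ̄_{v⃗}(hull(log_p(R_{v⃗}^×)))))`** at
`settingPrVolSharp` for the EXACT content family `m` of the slot unions — gen 0's `≤` (`thetaLocal_settingPrVolSharp_untopD_le_sum_content_hull`,
p438921; the capsule symmetry it needs is AUTOMATIC for an exact family, gen 0 `Cor312Vol.content_slotUnion_perm`) and the reverse
inequality above; for EVERY pilot data `X` over any number field, every non-zero Θ-ideles `t` and `q`-ideles `tq` (units off `S`).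
[cite: Mochizuki2012, IUTchIV Thm. 1.10 Step (v) p. 27–28] [cite: DupuyHilado2025, §4.7, §4.9, §4.12] -/
theorem thetaLocal_settingPrVolSharp_eq_sum_content_hull (ht0 : ∀ pp i x, t pp i x ≠ 0)
    (ht1 : ∀ (pp : Nat.Primes) (i : Fin X.lstar) (x : (thetaIndex X).Fibre (.inr pp)),
      haveI : Fact (pp : ℕ).Prime := ⟨pp.2⟩; placeOf X pp.1 x ∉ X.S → ‖t pp i x‖ = 1)
    (i : Fin (thetaIndex X).lstar) (pp : Nat.Primes)
    (m : ((thetaIndex X).Caps (Setting.labelSucc i) → (thetaIndex X).Fibre (.inr pp)) → ℤ)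
    (hm0 : ∀ e : (thetaIndex X).Caps (Setting.labelSucc i) → (thetaIndex X).Fibre (.inr pp),
      haveI : Fact (pp : ℕ).Prime := ⟨pp.2⟩
      (⋃ a, iota pp.1 ((presAt X hlog pp).kk e) a (t pp i (e a)) •
          (normalizedPacket pp.1 ((presAt X hlog pp).kk e) : Set ((presAt X hlog pp).X e))) ⊆
        (((pp : ℕ) : ℚ_[pp]) ^ m e) • (logPacket pp.1 ((presAt X hlog pp).kk e) : Set ((presAt X hlog pp).X e)))
    (hm1 : ∀ e : (thetaIndex X).Caps (Setting.labelSucc i) → (thetaIndex X).Fibre (.inr pp),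
      haveI : Fact (pp : ℕ).Prime := ⟨pp.2⟩
      ¬ (⋃ a, iota pp.1 ((presAt X hlog pp).kk e) a (t pp i (e a)) •
          (normalizedPacket pp.1 ((presAt X hlog pp).kk e) : Set ((presAt X hlog pp).X e))) ⊆
        (((pp : ℕ) : ℚ_[pp]) ^ (m e + 1)) • (logPacket pp.1 ((presAt X hlog pp).kk e) : Set ((presAt X hlog pp).X e))) :
    haveI : Fact (pp : ℕ).Prime := ⟨pp.2⟩
    (settingPrVolSharp X hlog M archPk archSub Ψ act Mmod region n lat sig split qData tq t htq0 htq1).thetaLocal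
        (Setting.labelSucc i) (.inr pp) =
      ((∑ e : (presAt X hlog pp).toLocalPieces.E (Setting.labelSucc i),
          weightPr X pp.1 (Setting.labelSucc i) e * (-(m e * Real.log pp) +
            packetLogμ pp.1 ((presAt X hlog pp).kk e)
              (packetHull pp.1 ((presAt X hlog pp).kk e)
                (logPacket pp.1 ((presAt X hlog pp).kk e) : Set ((presAt X hlog pp).X e)))) : ℝ) : WithTop ℝ) := by
  haveI : Fact (pp : ℕ).Prime := ⟨pp.2⟩
  have H := bridgeHyps_settingPrVolSharp_of_ideles X hlog M archPk archSub Ψ act Mmod region n lat sig split qData t tq ht0 ht1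
    htq0 htq1
  -- capsule symmetry of the EXACT content family (gen 0 `content_slotUnion_perm`)
  have hm : ∀ (σ : Equiv.Perm ((thetaIndex X).Caps (Setting.labelSucc i)))
      (e : (thetaIndex X).Caps (Setting.labelSucc i) → (thetaIndex X).Fibre (.inr pp)), m (e ∘ σ) = m e :=
    fun σ e => content_slotUnion_perm pp.1 ((presAt X hlog pp).kk e) σ (fun a => t pp i (e a)) (hm0 (e ∘ σ)) (hm1 (e ∘ σ))
      (hm0 e) (hm1 e)
  refine le_antisymm (thetaLocal_le_coe_of_untopD_le H i _
    (thetaLocal_settingPrVolSharp_untopD_le_sum_content_hull X hlog M archPk archSub Ψ act Mmod region n lat sig split qData t tq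
      ht0 ht1 htq0 htq1 i pp m hm fun e a => (Set.subset_iUnion _ a).trans (hm0 e))) ?_
  have hne : (settingPrVolSharp X hlog M archPk archSub Ψ act Mmod region n lat sig split qData tq t htq0 htq1).thetaLocal
      (Setting.labelSucc i) (.inr pp) ≠ ⊤ := H.finite.1 i _
  have hge := sum_content_hull_le_thetaLocal_settingPrVolSharp_untopD X hlog M archPk archSub Ψ act Mmod region n lat sig split
    qData t tq htq0 htq1 ht0 ht1 i pp m hm0 hm1
  obtain ⟨c, hc⟩ := WithTop.ne_top_iff_exists.mp hne
  rw [← hc] at hge ⊢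
  rw [WithTop.untopD_coe] at hge
  exact WithTop.coe_le_coe.mpr hge

/-- **THE ORBIT-HULL FORM, HYPOTHESIS-FREE: `−|log(Θ)|_{i+1,p} = ↑(Σ_{v⃗} Pr(v⃗)·log μ̄_{v⃗}(hull(⋃_{g∈Ind2} g·⋃_a ι_a(t_{Θ,i+1,v_a})·(R_I)^∼)))`**
at `settingPrVolSharp`, for EVERY pilot data `X` over any number field and every non-zero Θ-ideles `t` / `q`-ideles `tq` (units off `S`):
the slot union of non-zero slot scalars HAS an exact content (gen 0 `Cor312Vol.exists_content_slotUnion`), the orbit hull of a region of content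
`m` has log-measure `−m·log p + log μ̄(hull(log_p(R_I^×)))` (gen 0 `Cor312Vol.packetLogμ_packetHull_orbit_slotUnion_eq`, abc-iut-w5-d180), and the
previous theorem. Print's factorwise (Ind2) and Dupuy–Hilado's full lattice group `Aut(I_{v⃗})` give the SAME local Θ-volume at every
packet of the real log-shells of `F` (the `F`/`K`-level twin of abc-iut-s2-p9's `thetaLocal_settingPrVolSharpM_tOfIdeleData_eq_orbitSumM`).
[cite: Mochizuki2012, IUTchIII Thm. 3.11 (i) (Ind1), (Ind2) p. 154] [cite: Mochizuki2012, IUTchIV Thm. 1.10 Step (v) p. 27–28]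
[cite: DupuyHilado2025, §4.9, §4.11–4.12] -/
theorem thetaLocal_settingPrVolSharp_eq_sum_orbitHull (ht0 : ∀ pp i x, t pp i x ≠ 0)
    (ht1 : ∀ (pp : Nat.Primes) (i : Fin X.lstar) (x : (thetaIndex X).Fibre (.inr pp)),
      haveI : Fact (pp : ℕ).Prime := ⟨pp.2⟩; placeOf X pp.1 x ∉ X.S → ‖t pp i x‖ = 1)
    (i : Fin (thetaIndex X).lstar) (pp : Nat.Primes) :
    haveI : Fact (pp : ℕ).Prime := ⟨pp.2⟩
    (settingPrVolSharp X hlog M archPk archSub Ψ act Mmod region n lat sig split qData tq t htq0 htq1).thetaLocal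
        (Setting.labelSucc i) (.inr pp) =
      ((∑ e : (presAt X hlog pp).toLocalPieces.E (Setting.labelSucc i),
          weightPr X pp.1 (Setting.labelSucc i) e *
            packetLogμ pp.1 ((presAt X hlog pp).kk e)
              (packetHull pp.1 ((presAt X hlog pp).kk e)
                (⋃ g : indTwo pp.1 ((presAt X hlog pp).kk e),
                  g • ⋃ a, iota pp.1 ((presAt X hlog pp).kk e) a (t pp i (e a)) •
                    (normalizedPacket pp.1 ((presAt X hlog pp).kk e) : Set ((presAt X hlog pp).X e)))) : ℝ) :
        WithTop ℝ) := by
  haveI : Fact (pp : ℕ).Prime := ⟨pp.2⟩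
  -- the exact content at each tuple, chosen
  have h := fun e : (thetaIndex X).Caps (Setting.labelSucc i) → (thetaIndex X).Fibre (.inr pp) =>
    exists_content_slotUnion pp.1 ((presAt X hlog pp).kk e) (fun a => t pp i (e a)) (fun a => ht0 pp i (e a))
  choose m hm0 hm1 using h
  rw [thetaLocal_settingPrVolSharp_eq_sum_content_hull X hlog M archPk archSub Ψ act Mmod region n lat sig split qData t tq htq0
    htq1 ht0 ht1 i pp m hm0 hm1]
  congr 1
  refine Finset.sum_congr rfl fun e _ => ?_
  rw [packetLogμ_packetHull_orbit_slotUnion_eq pp.1 ((presAt X hlog pp).kk e) (fun a => t pp i (e a)) (hm0 e) (hm1 e)]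

end Real

end Thm311

end IUTFork

end Summit.ABC

end
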